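import Summits.Ventures.PercRepro.ProfilePointedCircuitClassesStarSharpD0C
import Summits.Ventures.PercRepro.ProfilePointedCircuitClassesStarSharpD0G
import Summits.Ventures.PercRepro.ProfilePointedCircuitClassesStarSharpD0M

/-!
# PercRepro — CASE D0 OF `StarNineSharp`, PART N: THE SAME PLANE, THE R0 SWAP AND THE R3′ POINT IN THE
«NO ON LINE THROUGH `e`, NO ON PLANE THROUGH `e, f`» REGIME (p5, gen 54; `proofs/P5-GM1.md` §81 ADD 1)

With ON lines allowed away from `e`: two ON rank-`3` sets through `e` sharing a point `z` of `X` lie in one plane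
(`same_plane_of_share`), a demand plane avoiding `f` holds at most three points of `X` (`trace_le_three`, from `f`
cosimple), the swap R0 (`π + f ∈ A` ON, any plane) injects into the ON targets avoiding `e` (`d0_injR0`), and the
R3′ point of a demand off `H` with ON complement is the opposite vertex when it is an OFF C-point, else an endpoint
(`r3'_point_spec`).
-/

open scoped Matroid

namespace PercRepro.Cogirth

open Finset ThmH Skew Shadow Profile

open Classical

variable {α : Type} [DecidableEq α] {N : Matroid α} [N.Finite]

section StarSharpD0N

variable {b b' : α}

/-- Condition R0: the swap `π + f + b` is a bi-independent ON set. -/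
def d0c0 (N : Matroid α) [N.Finite] (b b' e f : α) (W : Finset α) : Prop :=
  rk N (insert f ((W.erase b).erase e)) = 3 ∧ rk N (insert e (((((gr N).erase b).erase b').erase f).erase e \ (W.erase b).erase e)) = 4 ∧
    rk N (insert b (insert b' (insert f ((W.erase b).erase e)))) = 4

/-- **TWO ON RANK-3 SETS THROUGH `e` SHARING A POINT OF `X` SPAN THE SAME PLANE** (no ON line through `e`). -/
theorem same_plane_of_share (h : SeriesPair N b b') (hR : rk N (gr N) = 5) {e f : α}
    (hnle : ∀ S : Finset α, S ⊆ ((gr N).erase b).erase b' → e ∈ S → rk N (insert b (insert b' S)) ≤ 3 → rk N S ≤ 1)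
    (hE7 : rk N (((gr N).erase b).erase b') = 4)
    (he1 : ∀ y ∈ ((((gr N).erase b).erase b').erase f).erase e, rk N {e, y} = 2)
    {S₁ S₂ : Finset α} (hS₁ : S₁ ⊆ ((gr N).erase b).erase b') (hS₂ : S₂ ⊆ ((gr N).erase b).erase b')
    (he₁ : e ∈ S₁) (he₂ : e ∈ S₂) (hon₁ : rk N (insert b (insert b' S₁)) = 4)
    (hon₂ : rk N (insert b (insert b' S₂)) = 4) {z : α} (hz : z ∈ ((((gr N).erase b).erase b').erase f).erase e) (hz₁ : z ∈ S₁) (hz₂ : z ∈ S₂) :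
    rk N (S₁ ∪ S₂) ≤ 3 := by
  by_contra hne
  have hle : rk N (S₁ ∪ S₂) ≤ 4 := by
    have := rk_mono' (M := N) (union_subset hS₁ hS₂); omega
  have hU : rk N (S₁ ∪ S₂) = 4 := by omega
  have hI := rk_inter_le_one_of_two_on_e h hR hnle hS₁ hS₂ he₁ he₂ hon₁ hon₂ hU
  have h2 : rk N {e, z} ≤ rk N (S₁ ∩ S₂) := rk_mono' (M := N) (by
    intro w hw; simp only [mem_insert, mem_singleton] at hw
    rcases hw with rfl | rfl
    · exact mem_inter.2 ⟨he₁, he₂⟩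
    · exact mem_inter.2 ⟨hz₁, hz₂⟩)
  have := he1 z hz
  omega

/-- **A RANK-3 SET `S ∋ e` AVOIDING `f` HOLDS AT MOST THREE POINTS OF `X`** (`f` cosimple): four points of `X` with
`e` in a plane would make `E₇ − f − w` a plane. -/
theorem trace_le_three (hn : (gr N).card = 9) (h : SeriesPair N b b') {e f : α}
    (he : e ∈ gr N) (hf : f ∈ gr N) (hef : e ≠ f) (heb : e ≠ b) (heb' : e ≠ b') (hfb : f ≠ b) (hfb' : f ≠ b')
    (hfc : ∀ y ∈ ((((gr N).erase b).erase b').erase f).erase e, rk N (((((gr N).erase b).erase b').erase f).erase y) = 4)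
    (hX : rk N (((((gr N).erase b).erase b').erase f).erase e) = 4)
    {T : Finset α} (hT : T ⊆ ((((gr N).erase b).erase b').erase f).erase e) (hT3 : rk N (insert e T) ≤ 3) : T.card ≤ 3 := by
  by_contra hlt
  push Not at hlt
  have heE : e ∈ ((gr N).erase b).erase b' := mem_erase.2 ⟨heb', mem_erase.2 ⟨heb, he⟩⟩
  have hfE : f ∈ ((gr N).erase b).erase b' := mem_erase.2 ⟨hfb', mem_erase.2 ⟨hfb, hf⟩⟩
  have hE7c : (((gr N).erase b).erase b').card = 7 := by
    rw [card_erase_of_mem (mem_erase.2 ⟨h.2.2.1.symm, h.2.1⟩), card_erase_of_mem h.1, hn]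
  have hXc : (((((gr N).erase b).erase b').erase f).erase e).card = 5 := by
    rw [card_erase_of_mem (mem_erase.2 ⟨hef, heE⟩), card_erase_of_mem hfE, hE7c]
  have hc : (((((gr N).erase b).erase b').erase f).erase e \ T).card ≤ 1 := by
    rw [card_sdiff_of_subset hT, hXc]; omega
  have hT5 : T.card ≠ 5 := by
    intro h5
    have hTX : T = ((((gr N).erase b).erase b').erase f).erase e := eq_of_subset_of_card_le hT (by rw [hXc, h5])
    have h1 : rk N (((((gr N).erase b).erase b').erase f).erase e) ≤ rk N (insert e T) := by rw [← hTX]; exact rk_mono' (M := N) (subset_insert _ _)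
    omega
  have hne : (((((gr N).erase b).erase b').erase f).erase e \ T).Nonempty := by
    rw [← card_pos, card_sdiff_of_subset hT, hXc]
    have := card_le_card hT; rw [hXc] at this; omega
  obtain ⟨w, hw⟩ := hne
  have hsub : ((((gr N).erase b).erase b').erase f).erase w ⊆ insert e T := by
    intro x hx
    obtain ⟨hxw, hx'⟩ := mem_erase.1 hx
    obtain ⟨hxf, hxE⟩ := mem_erase.1 hx'
    rw [mem_insert]
    by_cases hxe : x = e
    · exact Or.inl hxe
    · right
      by_contra hxT
      have hxX : x ∈ ((((gr N).erase b).erase b').erase f).erase e \ T := mem_sdiff.2 ⟨mem_erase.2 ⟨hxe, mem_erase.2 ⟨hxf, hxE⟩⟩, hxT⟩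
      have h1 : ({w, x} : Finset α) ⊆ ((((gr N).erase b).erase b').erase f).erase e \ T := by
        intro y hy; simp only [mem_insert, mem_singleton] at hy
        rcases hy with rfl | rfl
        · exact hw
        · exact hxX
      have := card_le_card h1
      rw [card_pair hxw.symm] at this
      omega
  have := rk_mono' (M := N) hsub
  have hw' := hfc w (mem_sdiff.1 hw).1
  omega

/-- **RULE R0**: the ON demands whose swap `π + f + b` is a bi-independent ON set inject into the ON targets
avoiding `e`. -/
theorem d0_injR0 (h : SeriesPair N b b') (hn : (gr N).card = 9) {e f : α} (he : e ∈ gr N) (hf : f ∈ gr N) (hef : e ≠ f)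
    (heb : e ≠ b) (heb' : e ≠ b') (hfb : f ≠ b) (hfb' : f ≠ b') :
    ((d0DON N b' e f).filter (fun W => d0c0 N b b' e f W)).card ≤
      ((biIndepSets N 4).filter (fun W => (f ∈ W ∧ b' ∉ W) ∧ (e ∉ W ∧ b ∈ W ∧ ¬ (gr N \ W).erase b' ∈ biIndepSets N 4))).card := by
  have hb' : b' ∈ gr N := h.2.1; have hbb' : b ≠ b' := h.2.2.1
  have hXE : ((((gr N).erase b).erase b').erase f).erase e ⊆ ((gr N).erase b).erase b' := (erase_subset _ _).trans (erase_subset _ _)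
  have heE : e ∈ ((gr N).erase b).erase b' := mem_erase.2 ⟨heb', mem_erase.2 ⟨heb, he⟩⟩
  have hfE : f ∈ ((gr N).erase b).erase b' := mem_erase.2 ⟨hfb', mem_erase.2 ⟨hfb, hf⟩⟩
  have hE7c : (((gr N).erase b).erase b').card = 7 := by
    rw [card_erase_of_mem (mem_erase.2 ⟨hbb'.symm, hb'⟩), card_erase_of_mem h.1, hn]
  have hXc : (((((gr N).erase b).erase b').erase f).erase e).card = 5 := by
    rw [card_erase_of_mem (mem_erase.2 ⟨hef, heE⟩), card_erase_of_mem hfE, hE7c]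
  have heX : e ∉ ((((gr N).erase b).erase b').erase f).erase e := fun h' => (mem_erase.1 h').1 rfl
  have hfX : f ∉ ((((gr N).erase b).erase b').erase f).erase e := fun h' => (mem_erase.1 (mem_erase.1 h').2).1 rfl
  have hdata := d0_demand_data h hn hf hef heb hfb hfb' (e := e)
  apply card_le_card_of_injOn (fun W => insert b (insert f ((W.erase b).erase e)))
  · intro W hW
    simp only [d0DON, mem_coe, mem_filter] at hW
    obtain ⟨⟨hWs, hPD, hcW⟩, hc₀⟩ := hW
    obtain ⟨hbW, hπX, hπ2, hYeq, hWeq, hYr, hYc, hYon⟩ := hdata W hWs hPD hcW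
    obtain ⟨hπf, hcompl, hon⟩ := hc₀
    have hfπ : f ∉ (W.erase b).erase e := fun h' => hfX (hπX h')
    have heπ : e ∉ (W.erase b).erase e := fun h' => heX (hπX h')
    have hb'π : b' ∉ (W.erase b).erase e := fun h' => hPD.2 (mem_of_mem_erase (mem_of_mem_erase h'))
    have hfπE : insert f ((W.erase b).erase e) ⊆ ((gr N).erase b).erase b' := insert_subset hfE (hπX.trans hXE)
    have hfπ3 : (insert f ((W.erase b).erase e)).card = 3 := by rw [card_insert_of_notMem hfπ, hπ2]
    have him : insert b (insert f ((W.erase b).erase e)) ∈ biIndepSets N 4 := by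
      rw [insert_b_mem_biIndepSets_iff h hn hfπE hfπ3, E7_sdiff_insert_f_eq he hef heb heb' hπX]
      exact ⟨hπf, hcompl⟩
    simp only [mem_coe, mem_filter]
    refine ⟨him, ⟨mem_insert_of_mem (mem_insert_self _ _), ?_⟩, ?_, mem_insert_self _ _, ?_⟩
    · intro h'
      rcases mem_insert.1 h' with h2 | h2
      · exact hbb' h2.symm
      · rcases mem_insert.1 h2 with h3 | h3
        · exact hfb' h3.symm
        · exact hb'π h3
    · intro h'
      rcases mem_insert.1 h' with h2 | h2
      · exact heb h2
      · rcases mem_insert.1 h2 with h3 | h3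
        · exact hef h3
        · exact heπ h3
    · intro hc
      have e3 : (gr N \ insert b (insert f ((W.erase b).erase e))).erase b' =
          insert e (((((gr N).erase b).erase b').erase f).erase e \ (W.erase b).erase e) := by
        rw [sdiff_insert_b_eq hb' hbb' hfπE, erase_insert (fun h' => (mem_erase.1 (mem_sdiff.1 h').1).1 rfl),
          E7_sdiff_insert_f_eq he hef heb heb' hπX]
      rw [e3] at hc
      have hsE : insert e (((((gr N).erase b).erase b').erase f).erase e \ (W.erase b).erase e) ⊆ ((gr N).erase b).erase b' :=
        insert_subset heE (sdiff_subset.trans hXE)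
      have hs4 : (insert e (((((gr N).erase b).erase b').erase f).erase e \ (W.erase b).erase e)).card = 4 := by
        rw [card_insert_of_notMem (fun h' => heX (mem_sdiff.1 h').1), card_sdiff_of_subset hπX, hXc, hπ2]
      have e4 : ((gr N).erase b).erase b' \ insert e (((((gr N).erase b).erase b').erase f).erase e \ (W.erase b).erase e) =
          insert f ((W.erase b).erase e) := by
        rw [← E7_sdiff_insert_f_eq he hef heb heb' hπX, Finset.sdiff_sdiff_eq_self hfπE]
      rw [mem_biIndepSets_iff_of_subset_E7 h hn hsE hs4, e4] at hc
      omega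
  · intro W₁ hW₁ W₂ hW₂ heq
    simp only [d0DON, mem_coe, mem_filter] at hW₁ hW₂
    obtain ⟨hb₁, hπ₁, -, hYeq₁, hWeq₁, -, -, -⟩ := hdata W₁ hW₁.1.1 hW₁.1.2.1 hW₁.1.2.2
    obtain ⟨hb₂, hπ₂, -, hYeq₂, hWeq₂, -, -, -⟩ := hdata W₂ hW₂.1.1 hW₂.1.2.1 hW₂.1.2.2
    have hbπ : ∀ Y : Finset α, b ∉ insert f ((Y.erase b).erase e) := fun Y h' =>
      (mem_insert.1 h').elim (fun h2 => hfb h2.symm) (fun h2 => (mem_erase.1 (mem_of_mem_erase h2)).1 rfl)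
    have hfπ₁ : f ∉ (W₁.erase b).erase e := fun h' => hW₁.1.2.1.1.2 (mem_of_mem_erase (mem_of_mem_erase h'))
    have hfπ₂ : f ∉ (W₂.erase b).erase e := fun h' => hW₂.1.2.1.1.2 (mem_of_mem_erase (mem_of_mem_erase h'))
    have e1 : (W₁.erase b).erase e = (W₂.erase b).erase e := by
      have h1 : insert f ((W₁.erase b).erase e) = insert f ((W₂.erase b).erase e) := by
        have := congrArg (fun S => S.erase b) heq
        simp only [erase_insert (hbπ _)] at this
        exact this
      rw [← erase_insert hfπ₁, ← erase_insert hfπ₂, h1]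
    rw [← hWeq₁, ← hWeq₂, ← hYeq₁, ← hYeq₂, e1]

/-- **THE DATA OF AN R3′ DEMAND**: an ON demand off the `ef`-planes (`d0c1`) with ON complement. -/
theorem r3'_data (hn : (gr N).card = 9) (hR : rk N (gr N) = 5)
    (hcf : ∀ x ∈ gr N, rk N ((gr N).erase x) = 5) (h : SeriesPair N b b')
    {e f : α} (he : e ∈ gr N) (hf : f ∈ gr N) (hef : e ≠ f) (heb : e ≠ b) (heb' : e ≠ b') (hfb : f ≠ b) (hfb' : f ≠ b')
    (hE7 : rk N (((gr N).erase b).erase b') = 4)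
    (hnle : ∀ S : Finset α, S ⊆ ((gr N).erase b).erase b' → e ∈ S → rk N (insert b (insert b' S)) ≤ 3 → rk N S ≤ 1)
    (he1 : ∀ y ∈ ((((gr N).erase b).erase b').erase f).erase e, rk N {e, y} = 2)
    (hfc : ∀ y ∈ ((((gr N).erase b).erase b').erase f).erase e, rk N (((((gr N).erase b).erase b').erase f).erase y) = 4)
    (hX : rk N (((((gr N).erase b).erase b').erase f).erase e) = 4)
    {W : Finset α} (hWs : W ∈ biIndepSets N 4) (hPD : (e ∈ W ∧ f ∉ W) ∧ b' ∉ W)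
    (hcW : ¬ (gr N \ W).erase b' ∈ biIndepSets N 4) (hc1 : d0c1 N b e f W) (hnc₂ : ¬ d0c2 N b b' e f W) :
    b ∈ W ∧ (W.erase b).erase e ⊆ ((((gr N).erase b).erase b').erase f).erase e ∧ ((W.erase b).erase e).card = 2 ∧
      insert e ((W.erase b).erase e) = W.erase b ∧ insert b (W.erase b) = W ∧
      rk N (insert e ((W.erase b).erase e)) = 3 ∧
      rk N (insert f (((((gr N).erase b).erase b').erase f).erase e \ (W.erase b).erase e)) = 4 ∧
      rk N (insert b (insert b' (insert e ((W.erase b).erase e)))) = 4 ∧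
      rk N (insert f (insert e ((W.erase b).erase e))) = 4 ∧
      rk N (insert b (insert b' (((((gr N).erase b).erase b').erase f).erase e \ (W.erase b).erase e))) = 4 := by
  have _ := hR; have _ := hcf; have _ := hE7; have _ := hnle; have _ := he1; have _ := hfc; have _ := hX
  obtain ⟨hbW, hπX, hπ2, hYeq, hWeq, hYr, hYc, hYon⟩ := d0_demand_data h hn hf hef heb hfb hfb' W hWs hPD hcW
  have hXE : ((((gr N).erase b).erase b').erase f).erase e ⊆ ((gr N).erase b).erase b' := (erase_subset _ _).trans (erase_subset _ _)
  have hf4 : rk N (insert f (insert e ((W.erase b).erase e))) = 4 := hc1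
  have hS3 := d0_S3 h hn he hf hef heb heb' hfb hfb' _ hπX hπ2 hYc
  have hb := rk_insert_bb'_bounds h (sdiff_subset.trans hXE : ((((gr N).erase b).erase b').erase f).erase e \ (W.erase b).erase e ⊆ _)
  have hne : ¬ rk N (insert b (insert b' (((((gr N).erase b).erase b').erase f).erase e \ (W.erase b).erase e))) = 5 := hnc₂
  exact ⟨hbW, hπX, hπ2, hYeq, hWeq, hYr, hYc, hYon, hf4, by omega⟩



end StarSharpD0N

end PercRepro.Cogirth
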